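import Literature.Probability.LatticeModels.KCSectionFamilyLimits
import Literature.Probability.LatticeModels.KCMeshShadow
import Literature.Probability.LatticeModels.KCPrimitiveComponent
import Literature.Probability.LatticeModels.KCFamilyGauged
import Literature.Probability.LatticeModels.PlanarIsingTwoPointProofs
import HarnessLib

/-!
# The two-point spin-fermion family along the mesh: Kadanoff–Ceva data, bulk clauses and the four row-gauge charts

Topic `Literature/Probability/LatticeModels`. Chelkak–Hongler–Izyurov 2015, §2.1, Def. 2.1,
Prop. 2.4 and Prop. 3.6 for the TWO-POINT spinor observable `F_{[Ω_δ,a;b]}` (one background spin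
`b`, the case `k = 1` behind Theorems 1.5 (`k = 1`), 1.7 and Remark 2.18 of the source). This file
builds the concrete `KCSectionFamily` (`KCSectionFamily.lean`) of the observable on the discrete
domains `Ω_δ` of the tree and discharges the standing hypotheses of the `k ≥ 1` framework except
the bound on the primitive (an output of CHI's boundary argument, §3.4):

* `compVol Ω a δ` — the free volume: the lattice component of `nearestSite δ a` in
  `meshInteriorFinset Ω δ` (CHI's `Ω_δ` is connected; the tree's `meshInteriorFinset` need not be),
  with its closure, connectivity and adjacency properties;
* `twoPointData Ω a b δ` / **`twoPointFamily Ω a b`** — at a GOOD scale (`GoodScale`: the free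
  sites are hole-free and `nearestSite δ a` is free) the cut system, source normalisation
  `cut p₀ = ∅` at the source plaquette `p₀ = sourcePlaq δ a`, odd cuts elsewhere, the critical
  Kadanoff–Ceva primitive pair for `+` boundary values and background set `{nearestSite δ b}`, and
  the Dirichlet normalisation of `Hw` on the frozen boundary, all from
  `exists_kcCuts_primitive_mesh_part` (`twoPointData_spec`); `eventually_goodScale`;
* **`twoPointFamily_bulk`** and **`isNiceCore_twoPointFamily`** — the `bulk` clause of
  `IsNiceCore` off the exceptional set `{a, b}` (from `eventually_bulk_mem_compOf`), whence
  `IsNiceCore Ω {a, b} N` for any normalising function, GIVEN the bound `|Hw|, |Hb| ≤ M · N δ` on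
  compacts of `Ω ∖ {a, b}`;
* the signs: `lowSigns_eq` computes the two lower-corner sign products of the section with one
  background spin `b̂` (they are `-1` exactly on the right half-rows from the source site and from
  `b̂`, the second one differing at `b̂` itself), `twoPointGauge a b s t` are the four fields of row
  signs flipping the rows below the source row (`s = true`) and/or below the row of `b̂`
  (`t = true`), `twoPointChart Ω a b s t = Ω ∖ (ray_s a ∪ ray_t b)` the complementary charts
  (`ray_true c` the closed leftward horizontal ray from `c`, `ray_false c` the rightward one), which
  cover `Ω ∖ {a, b}` (`subset_iUnion_twoPointChart`), and **`isGauge_twoPointFamily`**: each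
  `twoPointGauge a b s t` is a gauge of the family over `twoPointChart Ω a b s t` (`IsGauge`), so
  that the precompactness / holomorphy / primitive machinery of `KCSectionFamily(Limits).lean`
  applies on the four charts.

Everything is proved; no named fact.

## References

* D. Chelkak, C. Hongler, K. Izyurov, *Conformal invariance of spin correlations in the planar
  Ising model*, Ann. of Math. 181 (2015), §2.1, Def. 2.1, Prop. 2.4, Prop. 3.6, §3.3
  [ChelkakHonglerIzyurovAnnals2015].
-/

noncomputable section

namespace Literature.Probability.LatticeModels

open Filter _root_.Topology Metric Set Finset Complex SimpleGraph
open Literature.Probability.LatticeModels.Polyomino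

/-! ### Small lattice geometry -/

/-- Coordinates of `cornerOff` are at most `1` in absolute value. [folklore] -/
theorem abs_cornerOff_apply_le (j : Fin 4) (i : Fin 2) : |cornerOff j i| ≤ 1 := by
  rcases cornerOff_apply_zero_or_one j i with h | h <;> simp [h]

/-- Mesh points of sites differing by a vector with coordinates in `[-1, 1]` are `2δ`-close. [folklore] -/
theorem dist_meshPoint_add_le {δ : ℝ} (hδ : 0 ≤ δ) (y v : Site 2) (h0 : |v 0| ≤ 1) (h1 : |v 1| ≤ 1) :
    dist (meshPoint δ (y + v)) (meshPoint δ y) ≤ 2 * δ := by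
  have h := dist_meshPoint_le_abs_add_abs δ (y + v) (meshPoint δ y)
  simp only [meshPoint_re, meshPoint_im, Pi.add_apply, Int.cast_add] at h
  rw [show δ * ((y 0 : ℝ) + v 0) - δ * y 0 = δ * v 0 by ring,
    show δ * ((y 1 : ℝ) + v 1) - δ * y 1 = δ * v 1 by ring, abs_mul, abs_mul, abs_of_nonneg hδ] at h
  have h0' : |(v 0 : ℝ)| ≤ 1 := by exact_mod_cast h0
  have h1' : |(v 1 : ℝ)| ≤ 1 := by exact_mod_cast h1
  calc dist (meshPoint δ (y + v)) (meshPoint δ y) ≤ δ * |(v 0 : ℝ)| + δ * |(v 1 : ℝ)| := h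
    _ ≤ δ * 1 + δ * 1 := by gcongr
    _ = 2 * δ := by ring

/-- The source plaquette is the south-west plaquette at the source site. [folklore] -/
theorem sourcePlaq_eq_faceAt (δ : ℝ) (a : ℂ) : sourcePlaq δ a = faceAt (nearestSite δ a) 2 := by
  obtain ⟨h0, h1⟩ := sourcePlaq_apply δ a
  ext i
  fin_cases i
  · show sourcePlaq δ a 0 = (nearestSite δ a - cornerOff 2) 0
    simp [h0]
  · show sourcePlaq δ a 1 = (nearestSite δ a - cornerOff 2) 1
    simp [h1]

/-- The source plaquette is `2δ`-close to the source site. [folklore] -/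
theorem dist_meshPoint_sourcePlaq_le {δ : ℝ} (hδ : 0 ≤ δ) (a : ℂ) :
    dist (meshPoint δ (sourcePlaq δ a)) (meshPoint δ (nearestSite δ a)) ≤ 2 * δ := by
  rw [sourcePlaq, add_assoc]
  exact dist_meshPoint_add_le hδ _ _ (by simp [Pi.add_apply]) (by simp [Pi.add_apply])

/-! ### The component volume -/

section Volume

variable (Ω : Set ℂ) (a : ℂ) (δ : ℝ)

open scoped Classical in
/-- **The free volume of the two-point family at mesh `δ`**: the lattice component of the source
site `nearestSite δ a` inside the free sites `meshInteriorFinset Ω δ` (empty when the source site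
is not free). [cite: ChelkakHonglerIzyurovAnnals2015, §2.1 (Ω_δ is a connected discrete domain)] -/
def compVol : Finset (Site 2) :=
  (meshInteriorFinset Ω δ).filter fun v => v ∈ compOf (↑(meshInteriorFinset Ω δ) : Set (Site 2)) (nearestSite δ a)

variable {Ω a δ}

/-- Membership in the component volume. [folklore] -/
theorem mem_compVol {v : Site 2} :
    v ∈ compVol Ω a δ ↔ v ∈ compOf (↑(meshInteriorFinset Ω δ) : Set (Site 2)) (nearestSite δ a) := by
  classical
  rw [compVol, Finset.mem_filter]
  exact ⟨fun h => h.2, fun h => ⟨Finset.mem_coe.1 (compOf_subset _ _ h), h⟩⟩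

/-- The component volume as a set. [folklore] -/
theorem coe_compVol :
    (↑(compVol Ω a δ) : Set (Site 2)) = compOf (↑(meshInteriorFinset Ω δ) : Set (Site 2)) (nearestSite δ a) := by
  ext v
  rw [Finset.mem_coe, mem_compVol]

/-- The component volume consists of free sites. [folklore] -/
theorem compVol_subset : compVol Ω a δ ⊆ meshInteriorFinset Ω δ := fun _ hv =>
  Finset.mem_coe.1 (compOf_subset _ _ (mem_compVol.1 hv))

/-- The component volume is closed under adjacency inside the free sites. [folklore] -/
theorem compVol_closed {x : Site 2} (hx : x ∈ compVol Ω a δ) {y : Site 2} (hy : y ∈ meshInteriorFinset Ω δ)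
    (hxy : (zdGraph 2).Adj x y) : y ∈ compVol Ω a δ :=
  mem_compVol.2 (mem_compOf_of_adj (mem_compVol.1 hx) (Finset.mem_coe.2 hy) hxy)

/-- The component volume is lattice-connected. [folklore] -/
theorem compVol_preconnected : ((zdGraph 2).induce (↑(compVol Ω a δ) : Set (Site 2))).Preconnected := by
  rw [coe_compVol]
  exact compOf_preconnected _ _

/-- A free source site lies in the component volume. [folklore] -/
theorem nearestSite_mem_compVol (h : nearestSite δ a ∈ meshInteriorFinset Ω δ) : nearestSite δ a ∈ compVol Ω a δ :=
  mem_compVol.2 (mem_compOf_self (Finset.mem_coe.2 h))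

/-- The four bonds at a site of the component volume are edges of the discrete domain. [folklore] -/
theorem compVol_adj {v : Site 2} (hv : v ∈ compVol Ω a δ) (k : Fin 4) :
    (discreteDomainGraph Ω δ).Adj v (v + cornerUnit k) :=
  discreteDomainGraph_adj_of_mem_meshInteriorFinset (compVol_subset hv) k

/-- At a free source site, the source plaquette touches the component volume. [folklore] -/
theorem sourcePlaq_mem_touchPlaquettes (h : nearestSite δ a ∈ meshInteriorFinset Ω δ) :
    sourcePlaq δ a ∈ touchPlaquettes (compVol Ω a δ) := by
  rw [sourcePlaq_eq_faceAt]
  exact faceAt_mem_touchPlaquettes (nearestSite_mem_compVol h) 2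

end Volume

/-! ### The data at a good scale and the family -/

section Data

variable (Ω : Set ℂ) (a b : ℂ) (δ : ℝ)

/-- **A good scale** (a predicate on the mesh `δ`, given the domain and the source point): the free
sites are hole-free as cells and the source site is free. [cite: ChelkakHonglerIzyurovAnnals2015, §2.1] -/
def GoodScale (Ω' : Set ℂ) (a' : ℂ) (δ' : ℝ) : Prop :=
  HoleFree (↑(meshInteriorFinset Ω' δ') : Set (Site 2)) ∧ nearestSite δ' a' ∈ meshInteriorFinset Ω' δ'

/-- **The specification of the two-point Kadanoff–Ceva data** `(cut, Hw, Hb)` on the component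
volume: admissible cuts on the filled plaquette set, no cut at the source plaquette, odd cuts at
every other touching plaquette, the critical primitive pair for `+` boundary values and the
background spin at `nearestSite δ b`, and the Dirichlet normalisation of `Hw` on the frozen
boundary sites. [cite: ChelkakHonglerIzyurovAnnals2015, Def. 2.1, Prop. 2.4, Prop. 3.6] -/
def DataSpec (d : (Site 2 → Finset (Sym2 (Site 2))) × (Site 2 → ℝ) × (Site 2 → ℝ)) : Prop :=
  IsKCCuts (discreteDomainGraph Ω δ) (compVol Ω a δ) d.1 ↑(fillFinset (touchPlaquettes (compVol Ω a δ))) ∧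
  d.1 (sourcePlaq δ a) = ∅ ∧
  (∀ p ∈ touchPlaquettes (compVol Ω a δ), p ≠ sourcePlaq δ a →
    Odd #(Finset.univ.filter fun j : Fin 4 => plaqSide p j ∈ d.1 p)) ∧
  IsKCPrimitive (discreteDomainGraph Ω δ) (compVol Ω a δ) criticalBetaTwo (.fixed 1) {nearestSite δ b} d.1 d.2.1 d.2.2
    ↑(fillFinset (touchPlaquettes (compVol Ω a δ))) ∧
  ∀ (v v' : Site 2) (k k' : Fin 4), v ∉ compVol Ω a δ → faceAt v k ∈ fillFinset (touchPlaquettes (compVol Ω a δ)) →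
    v' ∉ compVol Ω a δ → faceAt v' k' ∈ fillFinset (touchPlaquettes (compVol Ω a δ)) → d.2.1 v' = d.2.1 v

variable {Ω a δ} in
/-- **Existence of the data at a good scale** (`exists_kcCuts_primitive_mesh_part` on the component
volume). [cite: ChelkakHonglerIzyurovAnnals2015, Prop. 3.6 and §2.1] -/
theorem exists_dataSpec (h : GoodScale Ω a δ) :
    ∃ d : (Site 2 → Finset (Sym2 (Site 2))) × (Site 2 → ℝ) × (Site 2 → ℝ), DataSpec Ω a b δ d := by
  obtain ⟨cut, Hw, Hb, h1, h2, h3, h4, h5⟩ := exists_kcCuts_primitive_mesh_part Ω δ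
    (compVol_subset (Ω := Ω) (a := a) (δ := δ)) (fun x hx y hy hxy => compVol_closed hx hy hxy)
    compVol_preconnected h.1 (sourcePlaq_mem_touchPlaquettes h.2) criticalBetaTwo {nearestSite δ b}
  exact ⟨(cut, Hw, Hb), h1, h2, h3, h4, h5⟩

open scoped Classical in
/-- **The two-point Kadanoff–Ceva data at mesh `δ`** (a choice satisfying `DataSpec` at good scales,
trivial data otherwise). [cite: ChelkakHonglerIzyurovAnnals2015, Def. 2.1 and Prop. 3.6] -/
def twoPointData : (Site 2 → Finset (Sym2 (Site 2))) × (Site 2 → ℝ) × (Site 2 → ℝ) :=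
  if h : GoodScale Ω a δ then (exists_dataSpec b h).choose else (fun _ => ∅, 0, 0)

variable {Ω a δ} in
/-- The data satisfy their specification at good scales. [cite: ChelkakHonglerIzyurovAnnals2015, Prop. 3.6] -/
theorem twoPointData_spec (h : GoodScale Ω a δ) : DataSpec Ω a b δ (twoPointData Ω a b δ) := by
  classical
  rw [twoPointData, dif_pos h]
  exact (exists_dataSpec b h).choose_spec

/-- **The two-point spin-fermion family along the mesh**: free volume the component of the source
site, plaquette set the filled touching plaquettes, the data of `twoPointData`, and the single
background spin `nearestSite δ b`. [cite: ChelkakHonglerIzyurovAnnals2015, Def. 2.1 (F_{[Ω_δ,a;b]})] -/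
def twoPointFamily : KCSectionFamily where
  Λ := fun δ => compVol Ω a δ
  P := fun δ => ↑(fillFinset (touchPlaquettes (compVol Ω a δ)))
  cut := fun δ => (twoPointData Ω a b δ).1
  Hw := fun δ => (twoPointData Ω a b δ).2.1
  Hb := fun δ => (twoPointData Ω a b δ).2.2
  B := fun δ => {nearestSite δ b}

/-- Unfolding the fields of the family. [folklore] -/
theorem twoPointFamily_Λ : (twoPointFamily Ω a b).Λ δ = compVol Ω a δ := rfl

/-- Unfolding the fields of the family. [folklore] -/
theorem twoPointFamily_B : (twoPointFamily Ω a b).B δ = {nearestSite δ b} := rfl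

/-- Unfolding the fields of the family. [folklore] -/
theorem twoPointFamily_P : (twoPointFamily Ω a b).P δ = ↑(fillFinset (touchPlaquettes (compVol Ω a δ))) := rfl

/-- Unfolding the fields of the family. [folklore] -/
theorem twoPointFamily_cut : (twoPointFamily Ω a b).cut δ = (twoPointData Ω a b δ).1 := rfl

/-- Unfolding the fields of the family. [folklore] -/
theorem twoPointFamily_Hw : (twoPointFamily Ω a b).Hw δ = (twoPointData Ω a b δ).2.1 := rfl

/-- Unfolding the fields of the family. [folklore] -/
theorem twoPointFamily_Hb : (twoPointFamily Ω a b).Hb δ = (twoPointData Ω a b δ).2.2 := rfl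

variable {Ω a}

/-- **Small scales are good** when the discretisations approximate `Ω` and the free sites are
eventually hole-free (e.g. `Ω` a Jordan domain, `JordanDomain.holeFree_meshInteriorFinset`). [cite: ChelkakHonglerIzyurovAnnals2015, §2.1] -/
theorem eventually_goodScale (hΩo : IsOpen Ω) (hM : MeshApproximates Ω) (ha : a ∈ Ω)
    (hHF : ∀ᶠ δ in 𝓝[>] (0 : ℝ), HoleFree (↑(meshInteriorFinset Ω δ) : Set (Site 2))) :
    ∀ᶠ δ in 𝓝[>] (0 : ℝ), GoodScale Ω a δ :=
  hHF.and (eventually_nearestSite_mem_of_tendsto hΩo hM ha tendsto_const_nhds)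

end Data

/-! ### The bulk clauses -/

section Bulk

variable {Ω : Set ℂ} {a : ℂ}

/-- **The bulk clause of the two-point family off `{a, b}`.** For a compact `K ⊆ Ω ∖ {a, b}` there
is `ρ > 0` such that, for all small `δ`, every site within `ρ` of a site with mesh point in `K` is a
free site of the component volume other than the background spin, with its four bonds in the
discrete domain, its four plaquettes in the plaquette set, the four sides of its own plaquette
touching the volume and carrying an odd number of cut bonds. [cite: ChelkakHonglerIzyurovAnnals2015, §2.1 and §3.3] -/
theorem twoPointFamily_bulk (hΩo : IsOpen Ω) (hΩc : IsConnected Ω) (hM : MeshApproximates Ω) (ha : a ∈ Ω)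
    (hHF : ∀ᶠ δ in 𝓝[>] (0 : ℝ), HoleFree (↑(meshInteriorFinset Ω δ) : Set (Site 2))) (b : ℂ)
    {K : Set ℂ} (hKU : K ⊆ Ω \ {a, b}) (hK : IsCompact K) :
    ∃ ρ > 0, ∀ᶠ δ in 𝓝[>] (0 : ℝ), ∀ x y : Site 2, meshPoint δ x ∈ K → dist (meshPoint δ y) (meshPoint δ x) ≤ ρ →
      y ∈ (twoPointFamily Ω a b).Λ δ ∧ y ∉ (twoPointFamily Ω a b).B δ ∧
      edgeBoundary (discreteDomainGraph Ω δ) {y} = Finset.univ.image (fun k : Fin 4 => cSrc (y, k)) ∧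
      (∀ k : Fin 4, faceAt y k ∈ (twoPointFamily Ω a b).P δ) ∧
      (∀ j : Fin 4, s(y + cornerOff j, y + cornerOff j + cornerUnit j) ∈
        edgesTouching (discreteDomainGraph Ω δ) ((twoPointFamily Ω a b).Λ δ)) ∧
      Odd #(Finset.univ.filter fun j : Fin 4 =>
        s(y + cornerOff j, y + cornerOff j + cornerUnit j) ∈ (twoPointFamily Ω a b).cut δ y) := by
  obtain ⟨ρ₀, hρ₀, h₀⟩ := eventually_bulk_mem_compOf hΩo hΩc hM ha hK (hKU.trans sdiff_subset)
  have hdisj : Disjoint K ({a, b} : Set ℂ) := Set.disjoint_left.2 fun z hz hz' => (hKU hz).2 hz'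
  obtain ⟨η, hη, hηK⟩ := exists_pos_forall_lt_infDist hK (Set.toFinite {a, b}).isClosed hdisj ⟨a, mem_insert _ _⟩
  refine ⟨min (ρ₀ / 4) (η / 4), by positivity, ?_⟩
  have hδev : ∀ᶠ δ in 𝓝[>] (0 : ℝ), δ < min (ρ₀ / 4) (η / 4) :=
    mem_nhdsWithin_of_mem_nhds (Iio_mem_nhds (by positivity))
  filter_upwards [h₀, eventually_goodScale hΩo hM ha hHF, hδev, self_mem_nhdsWithin] with δ h₀ hgood hδ hδ0
  intro x y hx hxy
  have hδ0 : (0 : ℝ) < δ := hδ0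
  have hρ4 : min (ρ₀ / 4) (η / 4) ≤ ρ₀ / 4 := min_le_left _ _
  have hη4 : min (ρ₀ / 4) (η / 4) ≤ η / 4 := min_le_right _ _
  -- sites `2δ`-close to `y` are in the component volume
  have hnear : ∀ z : Site 2, dist (meshPoint δ z) (meshPoint δ y) ≤ 2 * δ → z ∈ compVol Ω a δ := fun z hz =>
    mem_compVol.2 (h₀ x z hx ((dist_triangle _ (meshPoint δ y) _).trans (by linarith))).2
  have hy : y ∈ compVol Ω a δ := hnear y (by rw [_root_.dist_self]; positivity)
  have hcorner : ∀ j : Fin 4, y + cornerOff j ∈ compVol Ω a δ := fun j =>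
    hnear _ (dist_meshPoint_add_le hδ0.le y (cornerOff j) (abs_cornerOff_apply_le j 0) (abs_cornerOff_apply_le j 1))
  have spec := twoPointData_spec b hgood
  -- `y` is far from `a` and `b`
  have hfar : ∀ c ∈ ({a, b} : Set ℂ), ∀ z : Site 2, dist (meshPoint δ z) c ≤ 3 * δ → z ≠ y := by
    rintro c hc z hz rfl
    have h1 : η < infDist (meshPoint δ x) {a, b} := hηK _ hx
    have h2 : infDist (meshPoint δ x) {a, b} ≤ dist (meshPoint δ x) c := infDist_le_dist_of_mem hc
    have h3 : dist (meshPoint δ x) c ≤ dist (meshPoint δ x) (meshPoint δ z) + dist (meshPoint δ z) c := dist_triangle _ _ _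
    rw [_root_.dist_comm] at hxy
    linarith
  refine ⟨hy, ?_, ?_, ?_, ?_, ?_⟩
  · rw [twoPointFamily_B, Finset.mem_singleton]
    exact fun h => hfar b (by simp) (nearestSite δ b) ((dist_meshPoint_nearestSite_le hδ0 b).trans (by linarith)) h.symm
  · exact edgeBoundary_singleton_eq (discreteDomainGraph Ω δ) (fun v hv k => compVol_adj hv k)
      (discreteDomainGraph_le_zdGraph Ω δ) hy
  · exact fun k => Finset.mem_coe.2 (subset_fillFinset _ (faceAt_mem_touchPlaquettes hy k))
  · intro j
    exact mem_edgesTouching_iff.2 ⟨(SimpleGraph.mem_edgeSet _).2 (compVol_adj (hcorner j) j), y + cornerOff j,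
      hcorner j, Sym2.mem_mk_left _ _⟩
  · have hyt : y ∈ touchPlaquettes (compVol Ω a δ) := by
      have h0 : faceAt y 0 = y := by ext i; simp [faceAt]
      simpa [h0] using faceAt_mem_touchPlaquettes hy 0
    have hne : y ≠ sourcePlaq δ a := by
      intro h
      refine hfar a (by simp) (sourcePlaq δ a) ?_ h.symm
      calc dist (meshPoint δ (sourcePlaq δ a)) a
          ≤ dist (meshPoint δ (sourcePlaq δ a)) (meshPoint δ (nearestSite δ a)) + dist (meshPoint δ (nearestSite δ a)) a :=
            dist_triangle _ _ _
        _ ≤ 2 * δ + δ := add_le_add (dist_meshPoint_sourcePlaq_le hδ0.le a) (dist_meshPoint_nearestSite_le hδ0 a)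
        _ = 3 * δ := by ring
    exact spec.2.2.1 y hyt hne

/-- **The two-point family is a nice family off `{a, b}`, given the bound on its primitive.** [cite: ChelkakHonglerIzyurovAnnals2015, §3.3–3.4] -/
theorem isNiceCore_twoPointFamily (hΩo : IsOpen Ω) (hΩc : IsConnected Ω) (hM : MeshApproximates Ω) (ha : a ∈ Ω)
    (hHF : ∀ᶠ δ in 𝓝[>] (0 : ℝ), HoleFree (↑(meshInteriorFinset Ω δ) : Set (Site 2))) (b : ℂ) {N : ℝ → ℝ}
    (hN : ∀ᶠ δ in 𝓝[>] (0 : ℝ), 0 < N δ)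
    (hbound : ∀ K ⊆ Ω \ {a, b}, IsCompact K → ∃ M > 0, ∀ᶠ δ in 𝓝[>] (0 : ℝ), ∀ y : Site 2, meshPoint δ y ∈ K →
      |(twoPointFamily Ω a b).Hw δ y| ≤ M * N δ ∧ |(twoPointFamily Ω a b).Hb δ y| ≤ M * N δ) :
    (twoPointFamily Ω a b).IsNiceCore Ω {a, b} N where
  adj := Eventually.of_forall fun _ v hv k => compVol_adj hv k
  cuts := by
    filter_upwards [eventually_goodScale hΩo hM ha hHF] with δ hδ
    exact (twoPointData_spec b hδ).1
  prim := by
    filter_upwards [eventually_goodScale hΩo hM ha hHF] with δ hδ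
    exact (twoPointData_spec b hδ).2.2.2.1
  pos := hN
  bulk K hKU hK := twoPointFamily_bulk hΩo hΩc hM ha hHF b hKU hK
  hbound := hbound

end Bulk

/-! ### The lower-corner signs with one background spin -/

section Signs

/-- The row sign of a single background spin. [folklore] -/
theorem rowSign_singleton (c : Site 2) (r : ℤ) : rowSign {c} r = if c 1 ≤ r then -1 else 1 := by
  classical
  rw [rowSign, Finset.filter_singleton]
  split_ifs <;> simp

/-- A horizontal bond `{v, v + e₀}` lies on the leftward ray of `c` iff it is on the row of `c`,
strictly to the left. [folklore] -/
theorem onLeftRay_east_iff (c v : Site 2) : OnLeftRay c s(v, v + cornerUnit 0) ↔ v 1 = c 1 ∧ v 0 < c 0 := by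
  constructor
  · rintro ⟨x, hx, h1, h0⟩
    rw [Sym2.eq_iff] at hx
    rcases hx with ⟨h, -⟩ | ⟨h, h'⟩
    · subst h
      exact ⟨h1, h0⟩
    · exfalso
      have h2 := congrFun h 0
      have h3 := congrFun h' 0
      simp [Pi.add_apply] at h2 h3
      omega
  · rintro ⟨h1, h0⟩
    exact ⟨v, rfl, h1, h0⟩

/-- The ray count of a single background spin on a horizontal bond. [folklore] -/
theorem rayCountB_singleton_east (c v : Site 2) :
    rayCountB {c} s(v, v + cornerUnit 0) = if v 1 = c 1 ∧ v 0 < c 0 then 1 else 0 := by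
  classical
  by_cases h : v 1 = c 1 ∧ v 0 < c 0
  · rw [if_pos h]
    have : ({c} : Finset (Site 2)).filter (fun b => OnLeftRay b s(v, v + cornerUnit 0)) = {c} := by
      ext b
      simp only [Finset.mem_filter, Finset.mem_singleton]
      exact ⟨fun hb => hb.1, fun hb => ⟨hb, hb ▸ (onLeftRay_east_iff c v).2 h⟩⟩
    simp only [rayCountB]
    convert congrArg Finset.card this using 1
    simp
  · rw [if_neg h]
    have : ({c} : Finset (Site 2)).filter (fun b => OnLeftRay b s(v, v + cornerUnit 0)) = ∅ := by
      ext b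
      simp only [Finset.mem_filter, Finset.mem_singleton, Finset.notMem_empty, iff_false, not_and]
      rintro rfl hb
      exact h ((onLeftRay_east_iff b v).1 hb)
    simp only [rayCountB]
    convert congrArg Finset.card this using 1
    simp

/-- **The lower-corner sign products of the section with one background spin `c`.** If the cuts
are admissible on the filled touching plaquettes of a connected volume of free sites of `Ω_δ`, the
source plaquette `p₀` touches the volume and carries no cut, and `y - e₁` is a free site, then
`hLowSign (y - e₀) · vLowSign (y - e₁) = ε_src · ε₂` and `vLowSign (y - e₁) · hLowSign y = ε_src · ε₃`
with `ε_src = -1` iff `y` is on the row above `p₀` strictly to the right of `p₀` (the right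
half-row from the source site), `ε₂ = -1` iff `y` is on the row of `c` strictly to the right of `c`,
and `ε₃ = -1` iff `y` is on the row of `c` at or to the right of `c`. [cite: ChelkakHonglerIzyurovAnnals2015, Prop. 2.4 and §3.2] -/
theorem lowSigns_eq {Ω : Set ℂ} {δ : ℝ} {Λ : Finset (Site 2)} (hΛ : Λ ⊆ meshInteriorFinset Ω δ)
    (hconn : ((zdGraph 2).induce (↑Λ : Set (Site 2))).Preconnected)
    {cut : Site 2 → Finset (Sym2 (Site 2))}
    (hcuts : IsKCCuts (discreteDomainGraph Ω δ) Λ cut ↑(fillFinset (touchPlaquettes Λ)))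
    {p₀ : Site 2} (hp₀ : p₀ ∈ touchPlaquettes Λ) (h0 : cut p₀ = ∅) (c : Site 2) {y : Site 2}
    (hy : y + cornerUnit 3 ∈ Λ) :
    (hLowSign {c} (y + cornerUnit 2) * vLowSign {c} cut (y + cornerUnit 3) =
      (if p₀ 1 = y 1 - 1 ∧ p₀ 0 < y 0 then -1 else 1) * (if y 1 = c 1 ∧ c 0 < y 0 then -1 else 1)) ∧
    (vLowSign {c} cut (y + cornerUnit 3) * hLowSign {c} y =
      (if p₀ 1 = y 1 - 1 ∧ p₀ 0 < y 0 then -1 else 1) * (if y 1 = c 1 ∧ c 0 ≤ y 0 then -1 else 1)) := by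
  obtain ⟨W, hW⟩ := usable_connectivity_of_preconnected hconn hp₀ _ (faceAt_mem_touchPlaquettes hy 1)
  have hv := vLowSign_eq_of_source (discreteDomainGraph Ω δ) (B := {c})
    (fun v hv k => discreteDomainGraph_adj_of_mem_meshInteriorFinset (hΛ hv) k) (discreteDomainGraph_le_zdGraph Ω δ)
    hcuts (Finset.coe_subset.2 (subset_fillFinset _)) h0 W hW
  have hstrip : (p₀ ∈ leftStrip (y + cornerUnit 3)) ↔ (p₀ 1 = y 1 - 1 ∧ p₀ 0 < y 0) := by
    simp only [leftStrip, Set.mem_setOf_eq, Pi.add_apply, cornerUnit_three_apply_one, cornerUnit_three_apply_zero]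
    constructor <;> rintro ⟨h1, h2⟩ <;> exact ⟨by omega, by omega⟩
  have c21 : (y + cornerUnit 2) 1 = y 1 := by simp [Pi.add_apply]
  have c20 : (y + cornerUnit 2) 0 = y 0 - 1 := by simp [Pi.add_apply]; ring
  have c31 : (y + cornerUnit 3) 1 = y 1 - 1 := by simp [Pi.add_apply]; ring
  simp only [hLowSign, hv, rowSign_singleton, rayCountB_singleton_east, hstrip, c21, c20, c31]
  constructor <;> split_ifs <;> norm_num <;> omega

end Signs

/-! ### The four row gauges and their charts -/

section Gauge

/-- The row sign flipping the rows below row `ρ`. [folklore] -/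
def rowFlip (ρ r : ℤ) : ℝ := if r < ρ then -1 else 1

/-- `rowFlip` is `±1`. [folklore] -/
theorem rowFlip_pm (ρ r : ℤ) : rowFlip ρ r = 1 ∨ rowFlip ρ r = -1 := by
  unfold rowFlip; split_ifs <;> simp

/-- The product of `rowFlip` over two consecutive rows is `-1` exactly at row `ρ`. [folklore] -/
theorem rowFlip_pred_mul_self (ρ r : ℤ) : rowFlip ρ (r - 1) * rowFlip ρ r = if r = ρ then -1 else 1 := by
  unfold rowFlip
  split_ifs <;> norm_num <;> omega

/-- **The four fields of row signs of the two-point family**: flip the rows below the source row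
(`s = true`) and/or below the row of the background spin (`t = true`). [cite: ChelkakHonglerIzyurovAnnals2015, §3.2 (choice of the sheet of the double cover)] -/
def twoPointGauge (a b : ℂ) (s t : Bool) (δ : ℝ) (r : ℤ) : ℝ :=
  (if s then rowFlip (nearestSite δ a 1) r else 1) * (if t then rowFlip (nearestSite δ b 1) r else 1)

/-- The gauges are `±1`. [folklore] -/
theorem twoPointGauge_pm (a b : ℂ) (s t : Bool) (δ : ℝ) (r : ℤ) :
    twoPointGauge a b s t δ r = 1 ∨ twoPointGauge a b s t δ r = -1 := by
  rcases rowFlip_pm (nearestSite δ a 1) r with ha | ha <;> rcases rowFlip_pm (nearestSite δ b 1) r with hb | hb <;>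
    cases s <;> cases t <;> norm_num [twoPointGauge, ha, hb]

/-- The product of a gauge over two consecutive rows. [folklore] -/
theorem twoPointGauge_pred_mul_self (a b : ℂ) (s t : Bool) (δ : ℝ) (r : ℤ) :
    twoPointGauge a b s t δ (r - 1) * twoPointGauge a b s t δ r =
      (if s = true ∧ r = nearestSite δ a 1 then -1 else 1) * (if t = true ∧ r = nearestSite δ b 1 then -1 else 1) := by
  have key : ∀ (u : Bool) (A : ℤ), (if u then rowFlip A (r - 1) else 1) * (if u then rowFlip A r else 1) =
      if u = true ∧ r = A then -1 else 1 := by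
    intro u A
    cases u <;> simp [rowFlip_pred_mul_self]
  rw [← key s, ← key t]
  unfold twoPointGauge
  ring

/-- **The seam rays**: `rowRay c true` is the closed horizontal ray from `c` to the LEFT,
`rowRay c false` the one to the RIGHT. [cite: ChelkakHonglerIzyurovAnnals2015, §3.2] -/
def rowRay (c : ℂ) (s : Bool) : Set ℂ := {z | z.im = c.im ∧ if s then z.re ≤ c.re else c.re ≤ z.re}

/-- The seam rays are closed. [folklore] -/
theorem isClosed_rowRay (c : ℂ) (s : Bool) : IsClosed (rowRay c s) := by
  cases s
  · simp only [rowRay, Bool.false_eq_true, if_false]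
    exact (isClosed_eq continuous_im continuous_const).inter (isClosed_le continuous_const continuous_re)
  · simp only [rowRay, if_true]
    exact (isClosed_eq continuous_im continuous_const).inter (isClosed_le continuous_re continuous_const)

/-- The base point lies on its seam rays. [folklore] -/
theorem self_mem_rowRay (c : ℂ) (s : Bool) : c ∈ rowRay c s := by
  cases s <;> simp [rowRay]

/-- **The charts of the two-point family**: `Ω` minus one seam ray from `a` and one from `b`. [cite: ChelkakHonglerIzyurovAnnals2015, §3.2] -/
def twoPointChart (Ω : Set ℂ) (a b : ℂ) (s t : Bool) : Set ℂ := Ω \ (rowRay a s ∪ rowRay b t)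

/-- The charts are open. [folklore] -/
theorem isOpen_twoPointChart {Ω : Set ℂ} (hΩo : IsOpen Ω) (a b : ℂ) (s t : Bool) : IsOpen (twoPointChart Ω a b s t) :=
  hΩo.sdiff ((isClosed_rowRay a s).union (isClosed_rowRay b t))

/-- The charts lie off the exceptional set. [folklore] -/
theorem twoPointChart_subset (Ω : Set ℂ) (a b : ℂ) (s t : Bool) : twoPointChart Ω a b s t ⊆ Ω \ {a, b} :=
  sdiff_subset_sdiff_right (insert_subset (mem_union_left _ (self_mem_rowRay a s))
    (singleton_subset_iff.2 (mem_union_right _ (self_mem_rowRay b t))))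

/-- **The four charts cover `Ω ∖ {a, b}`.** [folklore] -/
theorem subset_iUnion_twoPointChart (Ω : Set ℂ) (a b : ℂ) :
    Ω \ {a, b} ⊆ ⋃ i : Bool × Bool, twoPointChart Ω a b i.1 i.2 := by
  rintro z ⟨hzΩ, hz⟩
  simp only [mem_insert_iff, mem_singleton_iff, not_or] at hz
  have key : ∀ c : ℂ, z ≠ c → z ∉ rowRay c (decide (c.re < z.re)) := by
    intro c hzc h
    by_cases hc : c.re < z.re
    · simp only [rowRay, hc, decide_true, if_true, mem_setOf_eq] at h
      linarith [h.2]
    · simp only [rowRay, hc, decide_false, Bool.false_eq_true, if_false, mem_setOf_eq] at h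
      exact hzc (Complex.ext (le_antisymm (not_lt.1 hc) h.2) h.1)
  refine mem_iUnion.2 ⟨(decide (a.re < z.re), decide (b.re < z.re)), hzΩ, ?_⟩
  rintro (h | h)
  · exact key a hz.1 h
  · exact key b hz.2 h

/-- A site on the row of `nearestSite δ c`, on the closed side of it named by `s`, has its mesh
point within `δ` of the seam ray `rowRay c s`. [folklore] -/
theorem exists_mem_rowRay_dist_le {δ : ℝ} (hδ : 0 < δ) (c : ℂ) (s : Bool) {y : Site 2}
    (h1 : y 1 = nearestSite δ c 1) (h0 : if s then y 0 ≤ nearestSite δ c 0 else nearestSite δ c 0 ≤ y 0) :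
    ∃ q ∈ rowRay c s, dist (meshPoint δ y) q ≤ δ := by
  obtain ⟨hre, him⟩ := abs_coord_nearestSite_sub_le hδ c
  refine ⟨⟨c.re + δ * ((y 0 : ℝ) - nearestSite δ c 0), c.im⟩, ⟨rfl, ?_⟩, ?_⟩
  · cases s
    · simp only [Bool.false_eq_true, if_false] at h0 ⊢
      have : ((nearestSite δ c 0 : ℤ) : ℝ) ≤ y 0 := by exact_mod_cast h0
      nlinarith [mul_nonneg hδ.le (sub_nonneg.2 this)]
    · simp only [if_true] at h0 ⊢
      have : (y 0 : ℝ) ≤ nearestSite δ c 0 := by exact_mod_cast h0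
      nlinarith [mul_nonneg hδ.le (sub_nonneg.2 this)]
  · calc dist (meshPoint δ y) ⟨c.re + δ * ((y 0 : ℝ) - nearestSite δ c 0), c.im⟩
        ≤ |δ * (y 0 : ℝ) - (c.re + δ * ((y 0 : ℝ) - nearestSite δ c 0))| + |δ * (y 1 : ℝ) - c.im| :=
          dist_meshPoint_le_abs_add_abs δ y _
      _ = |δ * (nearestSite δ c 0 : ℝ) - c.re| + |δ * (nearestSite δ c 1 : ℝ) - c.im| := by
          rw [h1]; congr 1; ring_nf
      _ ≤ δ / 2 + δ / 2 := add_le_add hre him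
      _ = δ := by ring

/-- **Near a compact subset of a chart, eventually, no site is on the excluded half-rows**: a site
within `ρ` of the compact set and on the source row is strictly on the side of the source site not
excluded by the chart, and likewise for the row of the background spin. [cite: ChelkakHonglerIzyurovAnnals2015, §3.2] -/
theorem eventually_off_seams {Ω : Set ℂ} {a b : ℂ} {s t : Bool} {K : Set ℂ} (hK : IsCompact K)
    (hKU : K ⊆ twoPointChart Ω a b s t) :
    ∃ ρ > 0, ∀ᶠ δ in 𝓝[>] (0 : ℝ), ∀ x y : Site 2, meshPoint δ x ∈ K → dist (meshPoint δ y) (meshPoint δ x) ≤ ρ →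
      (y 1 = nearestSite δ a 1 → if s then nearestSite δ a 0 < y 0 else y 0 < nearestSite δ a 0) ∧
      (y 1 = nearestSite δ b 1 → if t then nearestSite δ b 0 < y 0 else y 0 < nearestSite δ b 0) := by
  set T : Set ℂ := rowRay a s ∪ rowRay b t
  have hT : IsClosed T := (isClosed_rowRay a s).union (isClosed_rowRay b t)
  have hdisj : Disjoint K T := Set.disjoint_left.2 fun z hz hz' => (hKU hz).2 hz'
  obtain ⟨η, hη, hηK⟩ := exists_pos_forall_lt_infDist hK hT hdisj ⟨a, Or.inl (self_mem_rowRay a s)⟩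
  refine ⟨η / 4, by positivity, ?_⟩
  have hδev : ∀ᶠ δ in 𝓝[>] (0 : ℝ), δ < η / 4 := mem_nhdsWithin_of_mem_nhds (Iio_mem_nhds (by positivity))
  filter_upwards [hδev, self_mem_nhdsWithin] with δ hδ hδ0
  intro x y hx hxy
  have hδ0 : (0 : ℝ) < δ := hδ0
  -- a site near `K` on a row through a marked point, on the excluded side, is too close to the rays
  have key : ∀ (c : ℂ) (u : Bool), rowRay c u ⊆ T → y 1 = nearestSite δ c 1 →
      ¬ (if u then y 0 ≤ nearestSite δ c 0 else nearestSite δ c 0 ≤ y 0) := by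
    intro c u hcT h1 h0
    obtain ⟨q, hq, hyq⟩ := exists_mem_rowRay_dist_le hδ0 c u h1 h0
    have h1 : η < infDist (meshPoint δ x) T := hηK _ hx
    have h2 : infDist (meshPoint δ x) T ≤ dist (meshPoint δ x) q := infDist_le_dist_of_mem (hcT hq)
    have h3 : dist (meshPoint δ x) q ≤ dist (meshPoint δ x) (meshPoint δ y) + dist (meshPoint δ y) q := dist_triangle _ _ _
    rw [_root_.dist_comm] at hxy
    linarith
  constructor
  · intro h1
    have := key a s subset_union_left h1
    cases s <;> simp only [Bool.false_eq_true, if_false, if_true, not_le] at this ⊢ <;> exact this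
  · intro h1
    have := key b t subset_union_right h1
    cases t <;> simp only [Bool.false_eq_true, if_false, if_true, not_le] at this ⊢ <;> exact this

/-- **Each of the four row gauges is a gauge of the two-point family over its chart.** [cite: ChelkakHonglerIzyurovAnnals2015, Prop. 2.4 and §3.2] -/
theorem isGauge_twoPointFamily {Ω : Set ℂ} {a : ℂ} (hΩo : IsOpen Ω) (hΩc : IsConnected Ω) (hM : MeshApproximates Ω)
    (ha : a ∈ Ω) (hHF : ∀ᶠ δ in 𝓝[>] (0 : ℝ), HoleFree (↑(meshInteriorFinset Ω δ) : Set (Site 2))) (b : ℂ)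
    (s t : Bool) : (twoPointFamily Ω a b).IsGauge (twoPointChart Ω a b s t) (twoPointGauge a b s t) where
  pm δ r := twoPointGauge_pm a b s t δ r
  sgn K hKU hK := by
    obtain ⟨ρ₁, hρ₁, h₁⟩ := eventually_off_seams hK hKU
    obtain ⟨ρ₀, hρ₀, h₀⟩ := eventually_bulk_mem_compOf hΩo hΩc hM ha hK
      (hKU.trans ((twoPointChart_subset Ω a b s t).trans sdiff_subset))
    refine ⟨min ρ₁ (ρ₀ / 2), by positivity, ?_⟩
    have hδev : ∀ᶠ δ in 𝓝[>] (0 : ℝ), δ < ρ₀ / 4 := mem_nhdsWithin_of_mem_nhds (Iio_mem_nhds (by positivity))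
    filter_upwards [h₁, h₀, eventually_goodScale hΩo hM ha hHF, hδev, self_mem_nhdsWithin] with δ h₁ h₀ hgood hδ hδ0
    intro x y hx hxy
    have hδ0 : (0 : ℝ) < δ := hδ0
    have hoff := h₁ x y hx (hxy.trans (min_le_left _ _))
    have hy3 : y + cornerUnit 3 ∈ compVol Ω a δ := by
      have hd : dist (meshPoint δ (y + cornerUnit 3)) (meshPoint δ y) ≤ 2 * δ :=
        dist_meshPoint_add_le hδ0.le y (cornerUnit 3) (by simp) (by simp)
      refine mem_compVol.2 (h₀ x _ hx ?_).2
      calc dist (meshPoint δ (y + cornerUnit 3)) (meshPoint δ x)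
          ≤ dist (meshPoint δ (y + cornerUnit 3)) (meshPoint δ y) + dist (meshPoint δ y) (meshPoint δ x) := dist_triangle _ _ _
        _ ≤ 2 * δ + min ρ₁ (ρ₀ / 2) := add_le_add hd hxy
        _ ≤ 2 * δ + ρ₀ / 2 := by gcongr; exact min_le_right _ _
        _ ≤ ρ₀ := by linarith
    have spec := twoPointData_spec b hgood
    have key := lowSigns_eq compVol_subset compVol_preconnected spec.1 (sourcePlaq_mem_touchPlaquettes hgood.2) spec.2.1
      (nearestSite δ b) hy3
    obtain ⟨hp0, hp1⟩ := sourcePlaq_apply δ a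
    rw [twoPointFamily_B, twoPointFamily_cut, twoPointGauge_pred_mul_self, key.1, key.2]
    obtain ⟨hoffa, hoffb⟩ := hoff
    cases s <;> cases t <;>
      simp only [Bool.false_eq_true, if_false, if_true, false_and, true_and] at hoffa hoffb ⊢ <;>
      constructor <;> split_ifs <;> norm_num <;> omega

end Gauge

end Literature.Probability.LatticeModels
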